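import Summits.Ventures.AbcSig.Rows.XTemplateHalves
import Summits.Ventures.AbcSig.Levels.N2528

/-!
# Venture AbcSig — PARITY-HALF ROW `C2aL79A3yoddAB`: `79^m·xⁿ + 8·yⁿ = z²`, `y` odd (class `a = 3`, second distribution) over the NORM-FORM level file 2528 = 32·79 (GENERATED by p-lean g4 `gen4/halfrow.py`)

HONEST FRAMING. A row of a COMPUTATION cell (`pub-abcsig`); a CONDITIONAL theorem, no claim on ABC or any summit.
Hypotheses: `BS04Package` (CITED: [BS04] Lemma 3.3 + (3.1) + Lemma 4.2); `DataComplete 2528` + `RefinesCPSymAll 2528` (COMPUTED: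
certified engine-1 level file; norm-form certificates `Sieve/CharpolyCert.lean`, prime-ideal trees where the norm form is weaker);
the listed per-orbit exclusions `hX_…` (CITED: the row of record's module closures — nothing of them is checked here).
Only the parity half living at the single level 32·79 is claimed (the complementary half needs level 2·79, not certified).
Exponent range: prime `n ≥ 11`, `n ≠ 79`, n ∉ [11]; `1 ≤ m < n`.
Residual of record R = {11} EXCLUDED in the statement (hres). No cited exclusion needed: every (orbit, exponent ≥ 11) pair is killed in the kernel.
Row of record: `census/rows/C2a/C2a-l79-a3-yodd.md` (sha16 `9520e6cbed525e56`; SIGNED 2026-08-22T16:05:08Z by referee (ref-g11)).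
-/

namespace Summit.Ventures.AbcSig

/-- Parity-half row `C2aL79A3yoddAB` (`79^m·xⁿ + 8·yⁿ = z²`, `y` odd (class `a = 3`, second distribution)); prime `n ≥ 11`, `n ≠ 79`, `n ∉ [11]`; conditional on the named hypotheses. -/
theorem xrow_C2aL79A3yoddAB (M : NewformModel) (hP : M.BS04Package)
    (hD2528 : M.DataComplete 2528 level2528Orbits) (hCP2528 : M.RefinesCPSymAll 2528 level2528CP)
    (n : ℕ) (hn : n.Prime) (hmin : 11 ≤ n) (hnℓ : n ≠ 79) (hres : n ∉ ([11] : List ℕ)) (m : ℕ) (hm : 1 ≤ m) (hmn : m < n)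

    (x y z : ℤ) (hy : ¬ 2 ∣ y) (hxy1 : x * y ≠ 1) (hxy2 : x * y ≠ -1) : ¬ IsPrimitiveSolution (79 ^ m) (2 ^ 3) 1 n x y z := by
  have hℓ : Nat.Prime 79 := by norm_num
  have h7 : 7 ≤ n := by omega
  exact xrowC2aAB_a3_yodd 79 hℓ (by norm_num) M hP n hn h7 hnℓ hD2528 m hm hmn
    (level2528_sieve M hP hCP2528 n hn h7 (fun o => M.Excludes 2528 o
      (famAB (79 ^ m) (2 ^ 3) n (fun _ _ => True)) ∨ M.ExcludesStd 2528 o n) (fun _ h => Or.inr h) (fun hmem => by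
      obtain rfl : n = 11 := by simpa using hmem
      exact absurd (by simp) hres) (fun hmem => by
      obtain rfl : n = 11 := by simpa using hmem
      exact absurd (by simp) hres))
    x y z hy hxy1 hxy2

end Summit.Ventures.AbcSig
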